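import Summits.CriticalPhenomena.PercolationContinuityZ3.Theses.PercNonProliferation
import Summits.CriticalPhenomena.PercolationContinuityZ3.Theorems.NonProliferation.Negative.AboveSix
import Summits.CriticalPhenomena.PercolationContinuityZ3.Theorems.NonProliferation.Negative.MZeroSlice
import Literature.Barriers.CriticalPhenomena.SpanningClustersAboveSix
import Literature.Probability.Percolation.RussoFormula

/-!
# Line `birth-merge-ledger` — checked skeleton for the crux `NonProliferation`
# (stmt-CriticalPhenomena-4444, route `PercNonProliferation`, rank 2)

Crux (fixed, by name): `PercNonProliferation.NonProliferation` —
`∃ M c, 0 < c ∧ ∃ᶠ n, c ≤ P_{p_c(ℤ³)}(N_n ≤ M)`, where `N_n` is the number of clusters of the open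
graph INDUCED on the free box `B(2n)` meeting both `B(n)` and `∂ⁱⁿB(2n)`, typed through
representatives: `{N_n ≤ M} = (repEvent 3 M n)ᶜ`
(`Theorems.NonProliferation.Negative.nonProliferation_iff`, `Iff.rfl`).

THE LINE (idea card `Cruxes/NonProliferation/Ideas/birth-merge-ledger.md`, triage r1-2 / r1-3 `pass`).
Run the monotone coupling `t ↦ ω_t` and read `N_n(t)` as a birth–death process in the parameter:
opening one lattice edge `e = {x,y} ⊆ B(2n)` changes `N_n` by `+1` (a BIRTH: it joins a piece meeting
`B(n)` but not `∂ⁱⁿB(2n)` to a piece meeting `∂ⁱⁿB(2n)` but not `B(n)`), by `-1` (a MERGE: it joins two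
distinct spanning clusters) or by `0`. Russo's formula for the bounded, NON-MONOTONE observable
`N_n = Σ_k 1{N_n ≥ k+1}` gives the LEDGER `E_b N_n - E_a N_n = ∫_a^b births - ∫_a^b merges`
(`stub_ledger`). The one new inequality of the card (SCREENING): a birth configuration at `e` with no
other spanning cluster is a pivotal configuration of the increasing crossing event
`annulusCrossing d n = {B(n) ↔ ∂ⁱⁿB(2n) in B(2n)}` (probability `u_n(t)`), and conditionally on the
two explored pieces the rest of the box is fresh Bernoulli, on which "no spanning cluster" is at least
as likely as on the full box: `(1 - u_n(t)) · births(t) ≤ u_n'(t)`; integrated from the trivial anchor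
`t = 0` this is the LOG-LEDGER `E_b N_n + ∫_0^b merges ≤ -log (1 - u_n(b))` (`stub_logLedger`, an
exponential sharpening of the route's `SpanningBKCap`, which only gives `u/(1-u)`). Consequence used
here: up to any parameter `s` with `u_n(s) ≤ 1/2` the expected number of births is `≤ log 2`.
What is left is the number of births INSIDE THE CRITICAL WINDOW `[s, p_c]`: `stub_windowBirths`
(the transfer target C⁺; OPEN, the hardest stub, the only place where `d = 3` enters).

* `stub_ledger` (KNOWN-TYPE, provable now, size L; every `d`, every `n`, `0 ≤ a ≤ b ≤ 1`): Russo's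
  formula for the integer count — `E_b[N_n] - E_a[N_n] = ∫_a^b births - ∫_a^b merges`, with
  `E_t[N_n] := Σ_{k < #B(n)} P_t(repEvent d k n)`, `births(t) := Σ_{e ∈ E(B(2n))} P_t(Δ_e N = +1)`,
  `merges(t) := Σ_{e ∈ E(B(2n))} P_t(Δ_e N = -1)` (the `±1` events spelled out through `openConnIn` on
  `ω ∖ {e}`). Stated on a GENERAL interval so that the upper anchor of the sibling idea `merger-budget`
  (integrate DOWN from a Peierls endpoint) plugs into the same registered identity.
* `stub_logLedger` (NEW but provable now, size L; every `d`, `n`, `b ∈ [0,1]` with `u_n(b) < 1`):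
  `E_b[N_n] + ∫_0^b merges ≤ -log (1 - u_n(b))` — screening inequality + Russo for the crossing event +
  `d/dt(-log(1-u)) = u'/(1-u)`; serves items 4446 (`SubpolynomialBlocking` then caps `E N_n ≤ s log n`)
  and 4458 (`PolynomialAssembly` closes with blocking as weak as `exp(-c n^{a/2})`) whatever happens here.
* `stub_windowBirths` (C⁺, OPEN, hardest; `d = 3` only): `∃ C, ∃ᶠ n, ∃ s ∈ [0, p_c], u_n(s) ≤ 1/2 ∧
  ∫_s^{p_c} births ≤ C` — boundedly many births after the crossing onset, along a subsequence.
* `NonProliferation_of : Stubs.stub_ledger → Stubs.stub_logLedger → Stubs.stub_windowBirths →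
  NonProliferation` (hypotheses = the stub `Prop`s BY NAME), PROVED here (no `sorry`; std axioms) as
  the `d = 3` instance of the dimension-general `nonProliferationDim_of_window`:
  `E_{p_c} N_n = E_s N_n + ∫_s^{p_c}(births - merges) ≤ log 2 + C` (`meanN_le_of_window`), then the
  first-moment bound `(M+1) P(N_n ≥ M+1) ≤ E N_n` (`markov_repEvent`, layer-cake over the antitone
  family `repEvent`, landed `Negative.repEvent_antitone`) with `M + 1 = 2⌈max C 0⌉₊ + 4` gives
  `P_{p_c}(N_n ≤ M) ≥ 1/2` frequently.
* `NonProliferation_proof : NonProliferation := NonProliferation_of stub_ledger stub_logLedger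
  stub_windowBirths` — the skeleton IS the crux proof once the three sorries are discharged.
* Barrier calibration CHECKED: `windowBirthsDim_false_above_six` / `windowBirthsDim_false_of_hara` —
  granted stubs 1–2, the `d`-dimensional window statement `WindowBirthsDim d` is false for every
  `d ≥ 7` with `TwoPointBoundedRatio d` (unconditionally `d ≥ 11` given `Hara2008_etaZeroXSpace`), by
  the same composition and the landed `Negative.nonProliferation_false_of_twoPointBoundedRatio`.

Disproof / Negative side honoured (`Cruxes/NonProliferation/Disproof.lean` v3; landed
`Theorems/NonProliferation/Negative/AboveSix.lean`, `MZeroSlice.lean`, both imported):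
`nonProliferation_false_without_dimThree` / `nonProliferation_false_above_six` — the dimension is
load-bearing. `stub_ledger` and `stub_logLedger` are stated for EVERY `d` and are consistent above six
dimensions (there they force `P_{p_c}(blocked) ≤ exp(-E N_n) ≤ exp(-c n^{d-6})`, no contradiction with
`real_repEvent_tendsto_one`); the line uses `H = (d = 3)` exactly at `stub_windowBirths`, which is stated
at `d = 3` only and IS false for `d ≥ 7` under `TwoPointBoundedRatio d` granted stubs 1–2
(`windowBirthsDim_false_above_six`, proved below: births in the window ≥ `E N_n - 1 → ∞`).
`M = 0` slice (`repEvent_zero_eq_annulusCrossing`, `nonProliferation_of_critAnnulusNonCrossing`): not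
used — the line never needs `limsup P_{p_c}(blocked) > 0`; it tolerates `u_n(p_c) → 1`. No stub is an
instance of a refuted strengthening (none recorded; `-- Targets` empty).
-/

noncomputable section

open MeasureTheory Filter Topology
open Literature.Probability.LatticeModels Literature.Probability.Percolation
open Literature.Barriers.CriticalPhenomena
open Summit.CriticalPhenomena.PercolationContinuityZ3.Theorems.NonProliferation.Negative

namespace Summit.CriticalPhenomena.PercolationContinuityZ3.Cruxes.NonProliferation.BirthMergeLedger

/-! ## The three registered stubs: precise `Prop`s `Stubs.stub_*` + sorried theorems `stub_*`

D-0027 §3.3 shape: `NonProliferation_of : Stubs.stub_ledger → Stubs.stub_logLedger →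
Stubs.stub_windowBirths → NonProliferation` (hypotheses = the declared stub `Prop`s, BY NAME), the
registered stubs `stub_* : <Stubs.stub_* spelled out> := by sorry` (signatures self-contained over tree
declarations: `bondPercolation`, `zdGraph`, `box`, `innerBoundary`, `edgesIn`, `openConnIn`,
`annulusCrossing`, `criticalProbI`, and the landed `Negative.repEvent`), and `NonProliferation_proof`.
Notation in comments: `P_t := bondPercolation (zdGraph d) (projIcc 0 1 t)`, `B := B(2n)`,
`∂ := ∂ⁱⁿB(2n)`, `ω' := ω ∖ {e}`; for a lattice edge `e` of `B`:
`Δ_e N = +1` iff for some orientation `e = s(x,y)`, `C_{ω'}(x)` meets `B(n)` and not `∂` while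
`C_{ω'}(y)` meets `∂` and not `B(n)` (the two orientations are disjoint events);
`Δ_e N = -1` iff `x ↮ y` in `ω'` and both `C_{ω'}(x)`, `C_{ω'}(y)` meet `B(n)` and `∂`
(clusters of the open graph induced on `B`, i.e. `openConnIn ↑B`). -/

namespace Stubs

/-- **Stub `Prop` 1 (`Ledger`)** — Russo's formula for the non-monotone count, integrated:
`E_b[N_n] - E_a[N_n] = ∫_a^b births - ∫_a^b merges` for `0 ≤ a ≤ b ≤ 1`, every `d`, `n`. -/
def stub_ledger : Prop :=
  ∀ (d n : ℕ) (a b : ℝ), 0 ≤ a → a ≤ b → b ≤ 1 →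
    (∑ k ∈ Finset.range (box d n).card,
        (bondPercolation (zdGraph d) (Set.projIcc (0 : ℝ) 1 zero_le_one b)).real (repEvent d k n)) -
      (∑ k ∈ Finset.range (box d n).card,
          (bondPercolation (zdGraph d) (Set.projIcc (0 : ℝ) 1 zero_le_one a)).real (repEvent d k n)) =
    (∫ t in a..b, ∑ e ∈ edgesIn (zdGraph d) (box d (2 * n)),
        (bondPercolation (zdGraph d) (Set.projIcc (0 : ℝ) 1 zero_le_one t)).real
          {ω : BondConfig (Site d) | ∃ x y : Site d, e = s(x, y) ∧
            (∃ v ∈ box d n, ω \ {e} ∈ openConnIn (↑(box d (2 * n)) : Set (Site d)) x v) ∧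
            (∀ w ∈ innerBoundary (zdGraph d) (box d (2 * n)),
              ω \ {e} ∉ openConnIn (↑(box d (2 * n)) : Set (Site d)) x w) ∧
            (∃ w ∈ innerBoundary (zdGraph d) (box d (2 * n)),
              ω \ {e} ∈ openConnIn (↑(box d (2 * n)) : Set (Site d)) y w) ∧
            (∀ v ∈ box d n, ω \ {e} ∉ openConnIn (↑(box d (2 * n)) : Set (Site d)) y v)}) -
    ∫ t in a..b, ∑ e ∈ edgesIn (zdGraph d) (box d (2 * n)),
        (bondPercolation (zdGraph d) (Set.projIcc (0 : ℝ) 1 zero_le_one t)).real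
          {ω : BondConfig (Site d) | ∃ x y : Site d, e = s(x, y) ∧
            ω \ {e} ∉ openConnIn (↑(box d (2 * n)) : Set (Site d)) x y ∧
            (∃ v ∈ box d n, ω \ {e} ∈ openConnIn (↑(box d (2 * n)) : Set (Site d)) x v) ∧
            (∃ w ∈ innerBoundary (zdGraph d) (box d (2 * n)),
              ω \ {e} ∈ openConnIn (↑(box d (2 * n)) : Set (Site d)) x w) ∧
            (∃ v ∈ box d n, ω \ {e} ∈ openConnIn (↑(box d (2 * n)) : Set (Site d)) y v) ∧
            (∃ w ∈ innerBoundary (zdGraph d) (box d (2 * n)),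
              ω \ {e} ∈ openConnIn (↑(box d (2 * n)) : Set (Site d)) y w)}

/-- **Stub `Prop` 2 (`LogLedger`)** — the screening inequality in its integrated (log) form:
`E_b[N_n] + ∫_0^b merges ≤ -log (1 - u_n(b))` whenever `u_n(b) := P_b(annulusCrossing d n) < 1`,
`0 ≤ b ≤ 1`, every `d`, `n`. -/
def stub_logLedger : Prop :=
  ∀ (d n : ℕ) (b : ℝ), 0 ≤ b → b ≤ 1 →
    (bondPercolation (zdGraph d) (Set.projIcc (0 : ℝ) 1 zero_le_one b)).real (annulusCrossing d n) < 1 →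
    (∑ k ∈ Finset.range (box d n).card,
        (bondPercolation (zdGraph d) (Set.projIcc (0 : ℝ) 1 zero_le_one b)).real (repEvent d k n)) +
      (∫ t in (0 : ℝ)..b, ∑ e ∈ edgesIn (zdGraph d) (box d (2 * n)),
        (bondPercolation (zdGraph d) (Set.projIcc (0 : ℝ) 1 zero_le_one t)).real
          {ω : BondConfig (Site d) | ∃ x y : Site d, e = s(x, y) ∧
            ω \ {e} ∉ openConnIn (↑(box d (2 * n)) : Set (Site d)) x y ∧
            (∃ v ∈ box d n, ω \ {e} ∈ openConnIn (↑(box d (2 * n)) : Set (Site d)) x v) ∧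
            (∃ w ∈ innerBoundary (zdGraph d) (box d (2 * n)),
              ω \ {e} ∈ openConnIn (↑(box d (2 * n)) : Set (Site d)) x w) ∧
            (∃ v ∈ box d n, ω \ {e} ∈ openConnIn (↑(box d (2 * n)) : Set (Site d)) y v) ∧
            (∃ w ∈ innerBoundary (zdGraph d) (box d (2 * n)),
              ω \ {e} ∈ openConnIn (↑(box d (2 * n)) : Set (Site d)) y w)}) ≤
    - Real.log (1 - (bondPercolation (zdGraph d) (Set.projIcc (0 : ℝ) 1 zero_le_one b)).real (annulusCrossing d n))

/-- **Stub `Prop` 3 (`WindowBirths`, the transfer target C⁺; OPEN, hardest; `d = 3`)** —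
boundedly many births after the crossing onset: `∃ C, ∃ᶠ n, ∃ s ∈ [0, p_c(ℤ³)]` with
`u_n(s) ≤ 1/2` and `∫_s^{p_c} births ≤ C`. -/
def stub_windowBirths : Prop :=
  ∃ C : ℝ, ∃ᶠ n : ℕ in atTop, ∃ s : ℝ, 0 ≤ s ∧ s ≤ (criticalProbI 3 : ℝ) ∧
    (bondPercolation (zdGraph 3) (Set.projIcc (0 : ℝ) 1 zero_le_one s)).real (annulusCrossing 3 n)
        ≤ 1 / 2 ∧
    ∫ t in s..(criticalProbI 3 : ℝ), ∑ e ∈ edgesIn (zdGraph 3) (box 3 (2 * n)),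
        (bondPercolation (zdGraph 3) (Set.projIcc (0 : ℝ) 1 zero_le_one t)).real
          {ω : BondConfig (Site 3) | ∃ x y : Site 3, e = s(x, y) ∧
            (∃ v ∈ box 3 n, ω \ {e} ∈ openConnIn (↑(box 3 (2 * n)) : Set (Site 3)) x v) ∧
            (∀ w ∈ innerBoundary (zdGraph 3) (box 3 (2 * n)),
              ω \ {e} ∉ openConnIn (↑(box 3 (2 * n)) : Set (Site 3)) x w) ∧
            (∃ w ∈ innerBoundary (zdGraph 3) (box 3 (2 * n)),
              ω \ {e} ∈ openConnIn (↑(box 3 (2 * n)) : Set (Site 3)) y w) ∧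
            (∀ v ∈ box 3 n, ω \ {e} ∉ openConnIn (↑(box 3 (2 * n)) : Set (Site 3)) y v)} ≤ C

end Stubs

/-- **stub 1 (registered) = `Stubs.stub_ledger` spelled out — the birth/merge LEDGER** (Russo's
formula for the bounded non-monotone observable `N_n` — Grimmett 1999, Thm (2.32), p. 46: `d/dp E_p X =
Σ_e E_p(δ_e X)` for `X` depending on finitely many edges; KNOWN-TYPE, provable now, size L).
For every `d`, `n` and `0 ≤ a ≤ b ≤ 1`:
`Σ_{k<#B(n)} P_b(repEvent d k n) - Σ_{k<#B(n)} P_a(repEvent d k n) = ∫_a^b births(t) dt - ∫_a^b merges(t) dt`.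
Proof route: `Σ_k P_t(repEvent d k n) = E_t[N_n]` with `N_n(ω)` the number of clusters of the open
graph induced on `B(2n)` meeting `B(n)` and `∂ⁱⁿB(2n)` (`N_n ≥ k+1 ↔ ω ∈ repEvent d k n`: one
representative in `B(n)` per cluster / distinct clusters give pairwise-unjoined representatives);
each `P_t(repEvent d k n)` is the cylinder polynomial `Russo.cylPoly` of an event determined by
`(box d (2n)).sym2` (`PlanarDuality.determinedBy_openConnIn`), so by `Russo.hasDerivAt_cylPoly` and
the pairing `S ↔ S ∪ {e}` (as in `Russo.sum_dweight_eq_measureReal_pivotal`, but WITHOUT monotonicity)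
`d/dt P_t(A) = Σ_e [P_t(ω ∪ e ∈ A, ω ∖ e ∉ A) - P_t(ω ∖ e ∈ A, ω ∪ e ∉ A)]`; summing over `k`,
`Σ_k (1{N(ω∪e) ≥ k+1} - 1{N(ω∖e) ≥ k+1}) = Δ_e N ∈ {-1, 0, +1}` and the case analysis of the header
(`Δ_e N = +1` iff a creation in one of the two orientations — disjoint events —, `-1` iff a merge);
finally the fundamental theorem of calculus on `[a,b]` (the rates are polynomials in `t ∈ [0,1]`,
continuous; endpoints `a = 0`, `b = 1` by continuity). `edgesIn` ranges over the lattice edges of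
`B(2n)` only (non-edges of `ℤ^d` are a.s. closed and never pivotal). -/
theorem stub_ledger :
    ∀ (d n : ℕ) (a b : ℝ), 0 ≤ a → a ≤ b → b ≤ 1 →
      (∑ k ∈ Finset.range (box d n).card,
          (bondPercolation (zdGraph d) (Set.projIcc (0 : ℝ) 1 zero_le_one b)).real (repEvent d k n)) -
        (∑ k ∈ Finset.range (box d n).card,
            (bondPercolation (zdGraph d) (Set.projIcc (0 : ℝ) 1 zero_le_one a)).real (repEvent d k n)) =
      (∫ t in a..b, ∑ e ∈ edgesIn (zdGraph d) (box d (2 * n)),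
          (bondPercolation (zdGraph d) (Set.projIcc (0 : ℝ) 1 zero_le_one t)).real
            {ω : BondConfig (Site d) | ∃ x y : Site d, e = s(x, y) ∧
              (∃ v ∈ box d n, ω \ {e} ∈ openConnIn (↑(box d (2 * n)) : Set (Site d)) x v) ∧
              (∀ w ∈ innerBoundary (zdGraph d) (box d (2 * n)),
                ω \ {e} ∉ openConnIn (↑(box d (2 * n)) : Set (Site d)) x w) ∧
              (∃ w ∈ innerBoundary (zdGraph d) (box d (2 * n)),
                ω \ {e} ∈ openConnIn (↑(box d (2 * n)) : Set (Site d)) y w) ∧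
              (∀ v ∈ box d n, ω \ {e} ∉ openConnIn (↑(box d (2 * n)) : Set (Site d)) y v)}) -
      ∫ t in a..b, ∑ e ∈ edgesIn (zdGraph d) (box d (2 * n)),
          (bondPercolation (zdGraph d) (Set.projIcc (0 : ℝ) 1 zero_le_one t)).real
            {ω : BondConfig (Site d) | ∃ x y : Site d, e = s(x, y) ∧
              ω \ {e} ∉ openConnIn (↑(box d (2 * n)) : Set (Site d)) x y ∧
              (∃ v ∈ box d n, ω \ {e} ∈ openConnIn (↑(box d (2 * n)) : Set (Site d)) x v) ∧
              (∃ w ∈ innerBoundary (zdGraph d) (box d (2 * n)),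
                ω \ {e} ∈ openConnIn (↑(box d (2 * n)) : Set (Site d)) x w) ∧
              (∃ v ∈ box d n, ω \ {e} ∈ openConnIn (↑(box d (2 * n)) : Set (Site d)) y v) ∧
              (∃ w ∈ innerBoundary (zdGraph d) (box d (2 * n)),
                ω \ {e} ∈ openConnIn (↑(box d (2 * n)) : Set (Site d)) y w)} := by
  sorry

/-- **stub 2 (registered) = `Stubs.stub_logLedger` spelled out — the SCREENING inequality, integrated
(the log-ledger; NEW, provable now, size L).** For every `d`, `n`, `b ∈ [0,1]` with
`u_n(b) = P_b(annulusCrossing d n) < 1`: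
`Σ_{k<#B(n)} P_b(repEvent d k n) + ∫_0^b merges(t) dt ≤ -log (1 - u_n(b))`.
Proof route: (i) pointwise screening `(1 - u_n(t)) · births(t) ≤ Σ_e P_t(e pivotal for
annulusCrossing d n)` for `t ∈ (0,1)`: the pivotal event of the increasing crossing event at the
lattice edge `e = {x,y}` is the DISJOINT union over the two orientations of
(creation clauses at `(x,y)`) ∩ {no cluster of `ω ∖ e` avoiding `C(x) ∪ C(y)` spans}; condition on the
explored pieces `(C_{ω∖e}(x), C_{ω∖e}(y)) = (I, O)` — an event determined by the edges touching
`I ∪ O` (stopping-set decoupling as in `StoppingSetDecoupling.lean` / `BondStoppingSetDecoupling.lean` /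
`ClusterExploration.lean`) —; the residual edges are fresh Bernoulli(`t`) and "no open crossing of
`B(2n) ∖ (I ∪ O)`" ⊇ "no open crossing of `B(2n)`" (`openConnIn_mono`), whose probability is
`1 - u_n(t)`. (ii) Russo for the increasing local event `annulusCrossing d n`
(`russo_formula_sum_holds`, determined by `(box d (2n)).sym2`): the right side of (i) is `u_n'(t)`.
(iii) With `stub_ledger` on `[0,t]`: `d/dt (E_t N + ∫_0^t merges) = births(t) ≤ u_n'/(1-u_n) =
d/dt (-log(1 - u_n))` on `(0,b)` (`u_n < 1` there since `u_n` is non-decreasing and `u_n(b) < 1`),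
anchors `E_0 N_n = 0 = u_n(0)` for `n ≥ 1` (at `t = 0` every edge is a.s. closed and
`B(n) ∩ ∂ⁱⁿB(2n) = ∅`; for `n = 0` the hypothesis fails when `d ≥ 1`, and all terms vanish when `d = 0`),
and integrate. Numerically (MC j008739, ratio 2, `d = 3`): `E N + merges ≈ 19.5`, so the lemma
PREDICTS `P_{p_c}(blocked) ≤ e^{-19.5}` (blocking is indeed never observed in 23 560 samples). -/
theorem stub_logLedger :
    ∀ (d n : ℕ) (b : ℝ), 0 ≤ b → b ≤ 1 →
      (bondPercolation (zdGraph d) (Set.projIcc (0 : ℝ) 1 zero_le_one b)).real (annulusCrossing d n) < 1 →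
      (∑ k ∈ Finset.range (box d n).card,
          (bondPercolation (zdGraph d) (Set.projIcc (0 : ℝ) 1 zero_le_one b)).real (repEvent d k n)) +
        (∫ t in (0 : ℝ)..b, ∑ e ∈ edgesIn (zdGraph d) (box d (2 * n)),
          (bondPercolation (zdGraph d) (Set.projIcc (0 : ℝ) 1 zero_le_one t)).real
            {ω : BondConfig (Site d) | ∃ x y : Site d, e = s(x, y) ∧
              ω \ {e} ∉ openConnIn (↑(box d (2 * n)) : Set (Site d)) x y ∧
              (∃ v ∈ box d n, ω \ {e} ∈ openConnIn (↑(box d (2 * n)) : Set (Site d)) x v) ∧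
              (∃ w ∈ innerBoundary (zdGraph d) (box d (2 * n)),
                ω \ {e} ∈ openConnIn (↑(box d (2 * n)) : Set (Site d)) x w) ∧
              (∃ v ∈ box d n, ω \ {e} ∈ openConnIn (↑(box d (2 * n)) : Set (Site d)) y v) ∧
              (∃ w ∈ innerBoundary (zdGraph d) (box d (2 * n)),
                ω \ {e} ∈ openConnIn (↑(box d (2 * n)) : Set (Site d)) y w)}) ≤
      - Real.log (1 - (bondPercolation (zdGraph d) (Set.projIcc (0 : ℝ) 1 zero_le_one b)).real (annulusCrossing d n)) := by
  sorry

/-- **stub 3 (registered) = `Stubs.stub_windowBirths` spelled out — births inside the critical window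
(the transfer target C⁺; OPEN, the hardest stub; the only place where `d = 3 < 6` enters).**
`∃ C, ∃ᶠ n, ∃ s ∈ [0, p_c(ℤ³)]`, `u_n(s) ≤ 1/2` and `∫_s^{p_c} births(t) dt ≤ C`: after a parameter
`s` at which the annulus `B(2n) ∖ B(n)` is crossed with probability at most `1/2`, the expected number
of NEW spanning clusters created up to `p_c` stays bounded along a subsequence (the optimal `s` is the
median crossing time `u_n(s) = 1/2`, which exists by continuity whenever `u_n(p_c) ≥ 1/2`; if
`u_n(p_c) < 1/2` take `s = p_c`, `C = 0`). Logical status: given stubs 1–2 it is EQUIVALENT to the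
card's `BirthBudget` (`∫_0^{p_c} births ≤ C'`: the births before `s` number `≤ log 2`) and to the
triage's `SecondaryBirthBudget` (the primary births integrate to `u_n(p_c) - u_n(0) ≤ 1` exactly),
hence to (mean-form crux) ∧ (`∫_s^{p_c} merges` bounded): STRONGER than the crux by the merge count,
not a restatement. Why it might fail: births AND merges could both creep up like `log n` with bounded
difference (MC j008739: births 18.0 → 19.9, merges 5.2 → 6.8 from `n = 8` to `32`, `E N = 13.3 ± 0.3`;
pre-registered reading of kit j011115–j011119, `n ≤ 64`, in TRIAGE-r1-2 §C); and no rigorous `d = 3`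
tool bounds the birth intensity `Σ_e P_t(Δ_e N = +1)` (anti-red bonds, `≍ n^{1/ν}` expected) against
the window width (`≍ n^{-1/ν}`) — both exponents are open; in `d ≥ 7` the statement is false
(`Negative.real_repEvent_tendsto_one` with stubs 1–2). Engines named by the card / triage:
AKN–Cerf two-arm bounds for birth sites (`exists_real_edgeTwoArms_le`, uniform in `t`), sharpness
below `p_c` (the integrand lives on the window), vdBHK two-cluster conditional association
(`BHK2006_twoClusterConditionalAssociation`) for the law of the born pair, and — exponent-free —
charging births to unit Russo budgets of increasing events (every birth edge is pivotal for the
max-flow level event `{F_n ≥ F_n(ω∖e) + 1}`, so `∫_0^{p_c} births ≤ E_{p_c} F_n`: a bounded MEAN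
critical min-cut `E_{p_c} F_n = O(1)` frequently — the mean form of the `l = 2` cousin of crux
stmt-CriticalPhenomena-5248, numerically `E F_n ≈ 29` — would suffice). -/
theorem stub_windowBirths :
    ∃ C : ℝ, ∃ᶠ n : ℕ in atTop, ∃ s : ℝ, 0 ≤ s ∧ s ≤ (criticalProbI 3 : ℝ) ∧
      (bondPercolation (zdGraph 3) (Set.projIcc (0 : ℝ) 1 zero_le_one s)).real (annulusCrossing 3 n)
          ≤ 1 / 2 ∧
      ∫ t in s..(criticalProbI 3 : ℝ), ∑ e ∈ edgesIn (zdGraph 3) (box 3 (2 * n)),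
          (bondPercolation (zdGraph 3) (Set.projIcc (0 : ℝ) 1 zero_le_one t)).real
            {ω : BondConfig (Site 3) | ∃ x y : Site 3, e = s(x, y) ∧
              (∃ v ∈ box 3 n, ω \ {e} ∈ openConnIn (↑(box 3 (2 * n)) : Set (Site 3)) x v) ∧
              (∀ w ∈ innerBoundary (zdGraph 3) (box 3 (2 * n)),
                ω \ {e} ∉ openConnIn (↑(box 3 (2 * n)) : Set (Site 3)) x w) ∧
              (∃ w ∈ innerBoundary (zdGraph 3) (box 3 (2 * n)),
                ω \ {e} ∈ openConnIn (↑(box 3 (2 * n)) : Set (Site 3)) y w) ∧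
              (∀ v ∈ box 3 n, ω \ {e} ∉ openConnIn (↑(box 3 (2 * n)) : Set (Site 3)) y v)} ≤ C := by
  sorry

/-! ## Vocabulary of the ledger (reducible abbreviations; the stubs above are these, spelled out) -/

/-- `P_t` on `ℤ^d`: bond percolation at the clamped real parameter `t`. -/
abbrev P (d : ℕ) (t : ℝ) : Measure (BondConfig (Site d)) :=
  bondPercolation (zdGraph d) (Set.projIcc (0 : ℝ) 1 zero_le_one t)

/-- `u_n(t) = P_t(B(n) ↔ ∂ⁱⁿB(2n) in B(2n))`. -/
abbrev crossProb (d : ℕ) (t : ℝ) (n : ℕ) : ℝ := (P d t).real (annulusCrossing d n)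

/-- `E_t[N_n] = Σ_{k < #B(n)} P_t(N_n ≥ k+1)` (layer-cake; `N_n ≤ #B(n)`). -/
abbrev meanN (d : ℕ) (t : ℝ) (n : ℕ) : ℝ :=
  ∑ k ∈ Finset.range (box d n).card, (P d t).real (repEvent d k n)

/-- `{Δ_e N_n = +1}`: opening `e` creates a new spanning cluster (read on `ω ∖ {e}`). -/
abbrev birthEvent (d n : ℕ) (e : Sym2 (Site d)) : Set (BondConfig (Site d)) :=
  {ω : BondConfig (Site d) | ∃ x y : Site d, e = s(x, y) ∧
    (∃ v ∈ box d n, ω \ {e} ∈ openConnIn (↑(box d (2 * n)) : Set (Site d)) x v) ∧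
    (∀ w ∈ innerBoundary (zdGraph d) (box d (2 * n)),
      ω \ {e} ∉ openConnIn (↑(box d (2 * n)) : Set (Site d)) x w) ∧
    (∃ w ∈ innerBoundary (zdGraph d) (box d (2 * n)),
      ω \ {e} ∈ openConnIn (↑(box d (2 * n)) : Set (Site d)) y w) ∧
    (∀ v ∈ box d n, ω \ {e} ∉ openConnIn (↑(box d (2 * n)) : Set (Site d)) y v)}

/-- `{Δ_e N_n = -1}`: opening `e` merges two distinct spanning clusters (read on `ω ∖ {e}`). -/
abbrev mergeEvent (d n : ℕ) (e : Sym2 (Site d)) : Set (BondConfig (Site d)) :=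
  {ω : BondConfig (Site d) | ∃ x y : Site d, e = s(x, y) ∧
    ω \ {e} ∉ openConnIn (↑(box d (2 * n)) : Set (Site d)) x y ∧
    (∃ v ∈ box d n, ω \ {e} ∈ openConnIn (↑(box d (2 * n)) : Set (Site d)) x v) ∧
    (∃ w ∈ innerBoundary (zdGraph d) (box d (2 * n)),
      ω \ {e} ∈ openConnIn (↑(box d (2 * n)) : Set (Site d)) x w) ∧
    (∃ v ∈ box d n, ω \ {e} ∈ openConnIn (↑(box d (2 * n)) : Set (Site d)) y v) ∧
    (∃ w ∈ innerBoundary (zdGraph d) (box d (2 * n)),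
      ω \ {e} ∈ openConnIn (↑(box d (2 * n)) : Set (Site d)) y w)}

/-- `births(t) = Σ_{e ∈ E(B(2n))} P_t(Δ_e N = +1)`. -/
abbrev birthRate (d : ℕ) (t : ℝ) (n : ℕ) : ℝ :=
  ∑ e ∈ edgesIn (zdGraph d) (box d (2 * n)), (P d t).real (birthEvent d n e)

/-- `merges(t) = Σ_{e ∈ E(B(2n))} P_t(Δ_e N = -1)`. -/
abbrev mergeRate (d : ℕ) (t : ℝ) (n : ℕ) : ℝ :=
  ∑ e ∈ edgesIn (zdGraph d) (box d (2 * n)), (P d t).real (mergeEvent d n e)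

/-- The stub `Prop`s are the abbreviations spelled out (definitional consistency, `Iff.rfl`). -/
theorem stub_ledger_iff :
    Stubs.stub_ledger ↔ ∀ (d n : ℕ) (a b : ℝ), 0 ≤ a → a ≤ b → b ≤ 1 →
      meanN d b n - meanN d a n = (∫ t in a..b, birthRate d t n) - ∫ t in a..b, mergeRate d t n :=
  Iff.rfl

theorem stub_logLedger_iff :
    Stubs.stub_logLedger ↔ ∀ (d n : ℕ) (b : ℝ), 0 ≤ b → b ≤ 1 → crossProb d b n < 1 →
      meanN d b n + (∫ t in (0 : ℝ)..b, mergeRate d t n) ≤ - Real.log (1 - crossProb d b n) :=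
  Iff.rfl

/-- The `d`-dimensional window statement (stub 3 is `WindowBirthsDim 3`, `Iff.rfl`): used to run the
composition in every dimension and to CHECK the barrier calibration (`windowBirthsDim_false_above_six`). -/
def WindowBirthsDim (d : ℕ) : Prop :=
  ∃ C : ℝ, ∃ᶠ n : ℕ in atTop, ∃ s : ℝ, 0 ≤ s ∧ s ≤ (criticalProbI d : ℝ) ∧
    crossProb d s n ≤ 1 / 2 ∧ ∫ t in s..(criticalProbI d : ℝ), birthRate d t n ≤ C

theorem stub_windowBirths_iff_dim : Stubs.stub_windowBirths ↔ WindowBirthsDim 3 := Iff.rfl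

/-! ## Proved glue: nonnegativity, the window bound on the mean, the first-moment bound -/

theorem mergeRate_nonneg (d : ℕ) (t : ℝ) (n : ℕ) : 0 ≤ mergeRate d t n :=
  Finset.sum_nonneg fun _ _ => measureReal_nonneg

/-- `-log(1 - u) ≤ 1` for `u ≤ 1/2` (`-log(1-u) = log (1-u)⁻¹ ≤ log 2 ≤ 1`). -/
theorem neg_log_one_sub_le_one {u : ℝ} (hu : u ≤ 1 / 2) : - Real.log (1 - u) ≤ 1 := by
  have h1 : (0 : ℝ) < 1 - u := by linarith
  have h2 : (1 - u)⁻¹ ≤ 2 := by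
    rw [inv_le_comm₀ h1 (by norm_num : (0 : ℝ) < 2)]
    linarith
  rw [← Real.log_inv]
  calc Real.log (1 - u)⁻¹ ≤ Real.log 2 := Real.log_le_log (inv_pos.2 h1) h2
    _ ≤ 2 - 1 := Real.log_le_sub_one_of_pos (by norm_num)
    _ = 1 := by norm_num

/-- **The window bound on the mean** (the analytic heart of the composition, every `d`, every end
point `p ≥ s`): from the ledger on `[s, p]`, the log-ledger at `s` with `u_n(s) ≤ 1/2`, and a window
birth budget `∫_s^p births ≤ C`: `E_p[N_n] ≤ C + 1`
(`E_p N = E_s N + ∫_s^p births - ∫_s^p merges ≤ (-log(1 - u_n(s)) - ∫_0^s merges) + C ≤ log 2 + C`). -/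
theorem meanN_le_of_window {d n : ℕ} {s p C : ℝ} (hs0 : 0 ≤ s) (hsp : s ≤ p)
    (hledger : meanN d p n - meanN d s n =
      (∫ t in s..p, birthRate d t n) - ∫ t in s..p, mergeRate d t n)
    (hlog : crossProb d s n < 1 →
      meanN d s n + (∫ t in (0 : ℝ)..s, mergeRate d t n) ≤ - Real.log (1 - crossProb d s n))
    (hus : crossProb d s n ≤ 1 / 2)
    (hwin : ∫ t in s..p, birthRate d t n ≤ C) :
    meanN d p n ≤ C + 1 := by
  have hm1 : 0 ≤ ∫ t in s..p, mergeRate d t n :=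
    intervalIntegral.integral_nonneg hsp fun t _ => mergeRate_nonneg d t n
  have hm0 : 0 ≤ ∫ t in (0 : ℝ)..s, mergeRate d t n :=
    intervalIntegral.integral_nonneg hs0 fun t _ => mergeRate_nonneg d t n
  have hlt : crossProb d s n < 1 := by linarith
  have hlog' := hlog hlt
  have hlog1 : - Real.log (1 - crossProb d s n) ≤ 1 := neg_log_one_sub_le_one hus
  linarith

/-- **First-moment (Markov) bound for the layered count**: `(M+1) · P(N_n ≥ M+1) ≤ E[N_n]`, i.e.
`(M+1) μ(repEvent d M n) ≤ Σ_{k<#B(n)} μ(repEvent d k n)` when `M + 1 ≤ #B(n)` (the family `repEvent`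
is antitone in `k`, landed `Negative.repEvent_antitone`). -/
theorem markov_repEvent {d M n : ℕ} (μ : Measure (BondConfig (Site d))) [IsFiniteMeasure μ]
    (hM : M + 1 ≤ (box d n).card) :
    ((M + 1 : ℕ) : ℝ) * μ.real (repEvent d M n) ≤
      ∑ k ∈ Finset.range (box d n).card, μ.real (repEvent d k n) := by
  calc ((M + 1 : ℕ) : ℝ) * μ.real (repEvent d M n)
      = ∑ _k ∈ Finset.range (M + 1), μ.real (repEvent d M n) := by
        rw [Finset.sum_const, Finset.card_range, nsmul_eq_mul]
    _ ≤ ∑ k ∈ Finset.range (M + 1), μ.real (repEvent d k n) := by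
        refine Finset.sum_le_sum fun k hk => ?_
        have hkM : k ≤ M := Nat.lt_succ_iff.1 (Finset.mem_range.1 hk)
        exact measureReal_mono (repEvent_antitone d n hkM) (measure_ne_top _ _)
    _ ≤ ∑ k ∈ Finset.range (box d n).card, μ.real (repEvent d k n) :=
        Finset.sum_le_sum_of_subset_of_nonneg (Finset.range_subset_range.2 hM)
          fun _ _ _ => measureReal_nonneg

/-- `#B(n) ≥ n + 1` in `ℤ^d`, `d ≥ 1` (`#B(n) = (2n+1)^d`). -/
theorem succ_le_card_box {d : ℕ} (hd : 1 ≤ d) (n : ℕ) : n + 1 ≤ (box d n).card := by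
  rw [card_box]
  calc n + 1 ≤ 2 * n + 1 := by omega
    _ ≤ (2 * n + 1) ^ d := Nat.le_self_pow (by omega) _

/-! ## The composition (kernel-checked, no `sorry`) — run in every dimension `d ≥ 1` -/

/-- **Composition in dimension `d`**: the ledger on `[s, p_c(d)]` and the log-ledger at `s` (both at
`d`) plus `WindowBirthsDim d` give the `d`-dimensional crux with `c = 1/2`: `E_{p_c}[N_n] ≤ C + 1`
(`meanN_le_of_window`), then `(M+1) P_{p_c}(N_n ≥ M+1) ≤ E N_n` with `M + 1 = 2⌈max C 0⌉₊ + 4 ≥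
2(C + 1)`, i.e. `P_{p_c}((repEvent d M n)ᶜ) ≥ 1/2` frequently. -/
theorem nonProliferationDim_of_window {d : ℕ} (hd : 1 ≤ d)
    (hL : ∀ (n : ℕ) (a b : ℝ), 0 ≤ a → a ≤ b → b ≤ 1 →
      meanN d b n - meanN d a n = (∫ t in a..b, birthRate d t n) - ∫ t in a..b, mergeRate d t n)
    (hS : ∀ (n : ℕ) (b : ℝ), 0 ≤ b → b ≤ 1 → crossProb d b n < 1 →
      meanN d b n + (∫ t in (0 : ℝ)..b, mergeRate d t n) ≤ - Real.log (1 - crossProb d b n))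
    (hW : WindowBirthsDim d) :
    ∃ (M : ℕ) (c : ℝ), 0 < c ∧ ∃ᶠ n : ℕ in atTop,
      c ≤ (bondPercolation (zdGraph d) (criticalProbI d)).real (repEvent d M n)ᶜ := by
  obtain ⟨C, hC⟩ := hW
  have hpc1 : (criticalProbI d : ℝ) ≤ 1 := (criticalProbI d).2.2
  set C' : ℝ := max C 0 with hC'def
  have hCC' : C ≤ C' := le_max_left _ _
  have hC'0 : 0 ≤ C' := le_max_right _ _
  set M : ℕ := 2 * ⌈C'⌉₊ + 3 with hMdef
  have hM2 : 2 * (C' + 1) ≤ ((M + 1 : ℕ) : ℝ) := by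
    have hceil : C' ≤ (⌈C'⌉₊ : ℝ) := Nat.le_ceil C'
    have hcast : ((M + 1 : ℕ) : ℝ) = 2 * (⌈C'⌉₊ : ℝ) + 4 := by
      rw [hMdef]; push_cast; ring
    rw [hcast]
    linarith
  refine ⟨M, 1 / 2, by norm_num, ?_⟩
  refine (hC.and_eventually (eventually_ge_atTop M)).mono ?_
  rintro n ⟨⟨s, hs0, hspc, hus, hwin⟩, hMn⟩
  -- the mean bound at `p_c`
  have hmean : meanN d (criticalProbI d : ℝ) n ≤ C + 1 :=
    meanN_le_of_window hs0 hspc (hL n s (criticalProbI d : ℝ) hs0 hspc hpc1)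
      (hS n s hs0 (hspc.trans hpc1)) hus hwin
  -- Markov
  have hcard : M + 1 ≤ (box d n).card :=
    le_trans (by omega) (succ_le_card_box hd n)
  have hmk := markov_repEvent (P d (criticalProbI d : ℝ)) (M := M) (n := n) hcard
  have hpos : (0 : ℝ) < ((M + 1 : ℕ) : ℝ) := by exact_mod_cast Nat.succ_pos M
  have hprod : ((M + 1 : ℕ) : ℝ) * (P d (criticalProbI d : ℝ)).real (repEvent d M n) ≤
      ((M + 1 : ℕ) : ℝ) * (1 / 2) := by
    have h1 : ((M + 1 : ℕ) : ℝ) * (P d (criticalProbI d : ℝ)).real (repEvent d M n) ≤ C' + 1 :=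
      hmk.trans (hmean.trans (by linarith))
    linarith
  have hP : (P d (criticalProbI d : ℝ)).real (repEvent d M n) ≤ 1 / 2 :=
    le_of_mul_le_mul_left hprod hpos
  -- back to the measure `P_{p_c}` itself: `projIcc 0 1 ↑p_c = p_c`
  have hproj : Set.projIcc (0 : ℝ) 1 zero_le_one (criticalProbI d : ℝ) = criticalProbI d :=
    Set.projIcc_val zero_le_one (criticalProbI d)
  have hP' : (bondPercolation (zdGraph d) (criticalProbI d)).real (repEvent d M n) ≤ 1 / 2 := by
    have h : (bondPercolation (zdGraph d) (Set.projIcc (0 : ℝ) 1 zero_le_one (criticalProbI d : ℝ))).real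
        (repEvent d M n) ≤ 1 / 2 := hP
    rw [hproj] at h
    exact h
  rw [probReal_compl_eq_one_sub (measurableSet_repEvent d M n)]
  linarith

/-- **Composition `NonProliferation_of`** — hypotheses = the three stub `Prop`s BY NAME, conclusion =
the crux BY NAME (`d = 3` instance of `nonProliferationDim_of_window` through
`Negative.nonProliferation_iff`). -/
theorem NonProliferation_of (hL : Stubs.stub_ledger) (hS : Stubs.stub_logLedger)
    (hW : Stubs.stub_windowBirths) :
    Summit.CriticalPhenomena.PercolationContinuityZ3.Theses.PercNonProliferation.NonProliferation := by
  rw [stub_ledger_iff] at hL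
  rw [stub_logLedger_iff] at hS
  rw [stub_windowBirths_iff_dim] at hW
  rw [nonProliferation_iff]
  exact nonProliferationDim_of_window (by norm_num) (hL 3) (hS 3) hW

/-- **The skeleton IS the crux proof once the three stubs are discharged** (D-0027 §3.3): the crux by
name from the registered stubs (its only non-standard axiom is the `sorryAx` of the stubs). -/
theorem NonProliferation_proof :
    Summit.CriticalPhenomena.PercolationContinuityZ3.Theses.PercNonProliferation.NonProliferation :=
  NonProliferation_of stub_ledger stub_logLedger stub_windowBirths

/-! ## Barrier calibration, checked: the window statement is FALSE above six dimensions

Given the two dimension-free stubs (which hold in every `d`), `WindowBirthsDim d` for `d ≥ 7` would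
give the `d`-dimensional crux, refuted by the landed `Negative.nonProliferation_false_of_twoPointBoundedRatio`
(Aizenman 1997 Thm 4 (3), `SpanningClustersAboveSix_holds`); so stub 3 is exactly where an input false
above six dimensions must enter (`Negative.nonProliferation_false_without_dimThree`). -/

/-- In every `d ≥ 7` satisfying Aizenman's (t-c) with `η = 0`, the window birth budget fails
(granted stubs 1–2): births in the critical window are NOT bounded — they exceed `E N_n → ∞`. -/
theorem windowBirthsDim_false_above_six (hL : Stubs.stub_ledger) (hS : Stubs.stub_logLedger) {d : ℕ}
    (hd : 6 < d) (hτ : TwoPointBoundedRatio d) : ¬ WindowBirthsDim d := by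
  rw [stub_ledger_iff] at hL
  rw [stub_logLedger_iff] at hS
  haveI : NeZero d := ⟨by omega⟩
  intro hW
  exact nonProliferation_false_of_twoPointBoundedRatio hd hτ
    (nonProliferationDim_of_window (by omega) (hL d) (hS d) hW)

/-- Unconditionally for `d ≥ 11`, granted Hara's `η = 0` (`Hara2008_etaZeroXSpace`). -/
theorem windowBirthsDim_false_of_hara (hL : Stubs.stub_ledger) (hS : Stubs.stub_logLedger)
    (hH : Hara2008_etaZeroXSpace) {d : ℕ} (hd : 11 ≤ d) : ¬ WindowBirthsDim d := by
  rw [stub_ledger_iff] at hL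
  rw [stub_logLedger_iff] at hS
  intro hW
  exact nonProliferation_false_of_hara hH hd (nonProliferationDim_of_window (by omega) (hL d) (hS d) hW)

end Summit.CriticalPhenomena.PercolationContinuityZ3.Cruxes.NonProliferation.BirthMergeLedger

end
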